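import Summits.ValiantsHypothesis.ValiantsHypothesis.Theorems.BarrierLeverChowThinRowsCrossSplit

/-!
# Route BarrierLever — item `ChowHitsThinRowPartitionMinors` (stmt-ValiantsHypothesis-20195):
# the CROSS (gluing) lemma for the first-order-rows slice — disjoint-variable unions serve crosses

Helper file (`--supports stmt-ValiantsHypothesis-20195`; cell valiant-natproofs, rung V4, 𝒟-side of
door (c); prover seat valiant-natproofs-prover gen 11).  Closes NO item; imports only the seat's
`…ChowThinRowsCrossSplit` (factorisation bookkeeping, over parts I–III of twin peeling; no route file).  Notation (`φ⁰_V`, `B_𝒦`,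
`E_V`, SPAN, POS) as in `…ChowThinRowsTwinPeelSpan`.

THE LEMMA (`span_union_of_cross`, `pos_union_of_cross`).  Split the column coordinates as `A ⊔ Aᶜ`.
Let `𝒦_A` be indicator forms on subsets of `A` and `𝒦_B` on subsets avoiding `A`; then
`B_{𝒦_A ∪ 𝒦_B} = B_{𝒦_A} · B_{𝒦_B}` and every leave-one-out product factorises, so on squarefree
monomials `coeff_{y^W} E_V = coeff_{y^{W ∩ A}} E^A_V · coeff_{y^{W \ A}} B_B` (`V ∈ 𝒦_A`) resp.
`coeff_{y^{W ∩ A}} B_A · coeff_{y^{W \ A}} E^B_V` (`V ∈ 𝒦_B`) — val-np-p7's block peel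
`coeff_partitionExpo_mul_block`.  For a PRODUCT column family `{a ∪ b : a ∈ 𝒲_A, b ∈ 𝒲_B}` this
union has rank at most `|𝒲_A| + |𝒲_B| - 1` and fails (planner g14, MEMO-thinrows §9: «a variable
split met by no common form is fatal», the square `{∅, a, b, ab}`).  But for a CROSS — every column
`W` has `A`-free part `W \ A = b₀` OR `A`-part `W ∩ A = a₀` — the union DOES have SPAN on `𝒲` as soon
as `𝒦_A` has SPAN on the `A`-parts, `𝒦_B` has SPAN on the `A`-free parts, and `B_A(a₀) ≠ 0`,
`B_B(b₀) ≠ 0`: the `A`-free side represents `X ↦ g(a₀ ∪ X)/B_A(a₀)`, the `A`-side the remainder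
`Y ↦ (g(Y ∪ b₀) - B_A(Y) g(a₀ ∪ b₀)/B_A(a₀))/B_B(b₀)` (and `0` at `Y = a₀`).  The typical cross is a
VERTEX GLUING: a family below an apex `a₀` together with a family above it (`b₀ = ∅`), e.g. two
squares glued at a vertex `{∅, 0, 1, 01, 012, 013, 0123}` — the smallest member of the 2-thick core
left by twin peeling (`…ChowThinRowsTwinPeel`), not twin-peelable, not of small shadow at `h = 6, 7`,
affinely dependent.

THE SLICE (`chowHits_firstOrderRows_of_crossSmallShadows`): columns forming a cross over `A` whose
`A`-parts (with `a₀`) and `A`-free parts (with `b₀`) have down-closures of total size `≤ h + h` are hit,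
at every height, on all injective rows of size `≤ 1` (item 20195's matrix verbatim) — both sides use
prover g10's down-closed base; either side may instead be certified by twin peeling through the
Λ-level lemmas (`exists_forms_of_twinPeeling` + `span_union_of_cross` + `chowHits_firstOrderRows_of_spanPos`).
With the cross move the exact `n = 4` census of the seat (lab/peel_cross.py) leaves, at minimal
height, only the 84 `S₄`-classes of 8-subsets of `2^[4]` at `h = 7` (each of which has a random 0/1
indicator witness with 7 forms — the frontier is the proof, not the statement).

WHAT THIS IS NOT: no statement for product-shaped or general 2-thick column families; nothing on rows
of size 2, on items 20195 / 20172 / 19717 themselves, on crux stmt-ValiantsHypothesis-14610, or on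
`VP` versus `VNP`.
-/

set_option linter.dupNamespace false

namespace Summit.ValiantsHypothesis.ValiantsHypothesis.Theorems.BarrierLever.ChowTwinPeel

open Finset MvPolynomial

variable {h : ℕ}

/-! ## 1. CROSS families: POS and SPAN for the union of an `A`-side and an `A`-free family -/

/-- **POS for a cross.** -/
theorem pos_union_of_cross (𝒦A 𝒦B : Finset (Finset (Fin h))) (A : Finset (Fin h))
    (𝒲 : Finset (Finset (Fin h)))
    (hA : ∀ V ∈ 𝒦A, V ⊆ A) (hB : ∀ V ∈ 𝒦B, ∀ c ∈ V, c ∉ A)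
    (hposA : ∀ W ∈ 𝒲, coeff (∑ a ∈ (∅ : Finset (Fin h)), Finsupp.single (Fin.castAdd h a) 1 +
        ∑ c' ∈ W.filter (fun c' => c' ∈ A), Finsupp.single (Fin.natAdd h c') 1)
      (∏ V ∈ 𝒦A, (C 1 + ∑ a, C ((fun (_ : Fin h) (_ : Finset (Fin h)) => (0 : ℂ)) a V) *
        X (Fin.castAdd h a) + ∑ c', C (if c' ∈ V then (1 : ℂ) else 0) * X (Fin.natAdd h c') :
          MvPolynomial (Fin (h + h)) ℂ)) ≠ 0)
    (hposB : ∀ W ∈ 𝒲, coeff (∑ a ∈ (∅ : Finset (Fin h)), Finsupp.single (Fin.castAdd h a) 1 +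
        ∑ c' ∈ W.filter (fun c' => c' ∉ A), Finsupp.single (Fin.natAdd h c') 1)
      (∏ V ∈ 𝒦B, (C 1 + ∑ a, C ((fun (_ : Fin h) (_ : Finset (Fin h)) => (0 : ℂ)) a V) *
        X (Fin.castAdd h a) + ∑ c', C (if c' ∈ V then (1 : ℂ) else 0) * X (Fin.natAdd h c') :
          MvPolynomial (Fin (h + h)) ℂ)) ≠ 0) :
    ∀ W ∈ 𝒲, coeff (∑ a ∈ (∅ : Finset (Fin h)), Finsupp.single (Fin.castAdd h a) 1 +
        ∑ c' ∈ W, Finsupp.single (Fin.natAdd h c') 1)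
      (∏ V ∈ 𝒦A ∪ 𝒦B, (C 1 + ∑ a, C ((fun (_ : Fin h) (_ : Finset (Fin h)) => (0 : ℂ)) a V) *
        X (Fin.castAdd h a) + ∑ c', C (if c' ∈ V then (1 : ℂ) else 0) * X (Fin.natAdd h c') :
          MvPolynomial (Fin (h + h)) ℂ)) ≠ 0 := by
  intro W hW
  rw [coeff_prod_union_split 𝒦A 𝒦B A hA hB W]
  exact mul_ne_zero (hposA W hW) (hposB W hW)

/-- **SPAN for a CROSS (the gluing lemma).**  Let `𝒦_A` consist of subsets of `A` and `𝒦_B` of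
subsets avoiding `A`, and let the columns form a CROSS: every `W ∈ 𝒲` has `A`-free part `b₀` or
`A`-part `a₀` (e.g. a family below an apex glued to a family above it: `a₀ = ` apex, `b₀ = ∅`).  If
`𝒦_A` has SPAN on the `A`-parts `{W ∩ A}`, `𝒦_B` has SPAN on the `A`-free parts `{W \ A}`, and the
full products are nonzero at `a₀` resp. `b₀`, then `𝒦_A ∪ 𝒦_B` has SPAN on `𝒲`.  (For a PRODUCT
family `{a ∪ b}` instead of a cross the same union is rank-deficient — planner g14's «a variable split
met by no common form is fatal»; the cross is exactly the shape a disjoint-variable union can serve.)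
Targets: `g_B(X) = g(a₀ ∪ X)/B_A(a₀)` on the `A`-free side and
`g_A(Y) = (g(Y ∪ b₀) - B_A(Y)·g(a₀ ∪ b₀)/B_A(a₀))/B_B(b₀)` (`Y ≠ a₀`), `g_A(a₀) = 0`. -/
theorem span_union_of_cross (𝒦A 𝒦B : Finset (Finset (Fin h))) (A a₀ b₀ : Finset (Fin h))
    (𝒲 : Finset (Finset (Fin h)))
    (hA : ∀ V ∈ 𝒦A, V ⊆ A) (hB : ∀ V ∈ 𝒦B, ∀ c ∈ V, c ∉ A)
    (hcross : ∀ W ∈ 𝒲, W.filter (fun c' => c' ∉ A) = b₀ ∨ W.filter (fun c' => c' ∈ A) = a₀)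
    (ha₀ : coeff (∑ a ∈ (∅ : Finset (Fin h)), Finsupp.single (Fin.castAdd h a) 1 +
        ∑ c' ∈ a₀, Finsupp.single (Fin.natAdd h c') 1)
      (∏ V ∈ 𝒦A, (C 1 + ∑ a, C ((fun (_ : Fin h) (_ : Finset (Fin h)) => (0 : ℂ)) a V) *
        X (Fin.castAdd h a) + ∑ c', C (if c' ∈ V then (1 : ℂ) else 0) * X (Fin.natAdd h c') :
          MvPolynomial (Fin (h + h)) ℂ)) ≠ 0)
    (hb₀ : coeff (∑ a ∈ (∅ : Finset (Fin h)), Finsupp.single (Fin.castAdd h a) 1 +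
        ∑ c' ∈ b₀, Finsupp.single (Fin.natAdd h c') 1)
      (∏ V ∈ 𝒦B, (C 1 + ∑ a, C ((fun (_ : Fin h) (_ : Finset (Fin h)) => (0 : ℂ)) a V) *
        X (Fin.castAdd h a) + ∑ c', C (if c' ∈ V then (1 : ℂ) else 0) * X (Fin.natAdd h c') :
          MvPolynomial (Fin (h + h)) ℂ)) ≠ 0)
    (hspanA : ∀ g : Finset (Fin h) → ℂ, ∃ cV : Finset (Fin h) → ℂ, ∀ W ∈ 𝒲,
      ∑ V ∈ 𝒦A, cV V * coeff (∑ a ∈ (∅ : Finset (Fin h)), Finsupp.single (Fin.castAdd h a) 1 +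
        ∑ c' ∈ W.filter (fun c' => c' ∈ A), Finsupp.single (Fin.natAdd h c') 1)
        (∏ V' ∈ 𝒦A.erase V, (C 1 + ∑ a, C ((fun (_ : Fin h) (_ : Finset (Fin h)) => (0 : ℂ)) a V') *
        X (Fin.castAdd h a) + ∑ c', C (if c' ∈ V' then (1 : ℂ) else 0) * X (Fin.natAdd h c') :
          MvPolynomial (Fin (h + h)) ℂ)) = g (W.filter (fun c' => c' ∈ A)))
    (hspanB : ∀ g : Finset (Fin h) → ℂ, ∃ cV : Finset (Fin h) → ℂ, ∀ W ∈ 𝒲,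
      ∑ V ∈ 𝒦B, cV V * coeff (∑ a ∈ (∅ : Finset (Fin h)), Finsupp.single (Fin.castAdd h a) 1 +
        ∑ c' ∈ W.filter (fun c' => c' ∉ A), Finsupp.single (Fin.natAdd h c') 1)
        (∏ V' ∈ 𝒦B.erase V, (C 1 + ∑ a, C ((fun (_ : Fin h) (_ : Finset (Fin h)) => (0 : ℂ)) a V') *
        X (Fin.castAdd h a) + ∑ c', C (if c' ∈ V' then (1 : ℂ) else 0) * X (Fin.natAdd h c') :
          MvPolynomial (Fin (h + h)) ℂ)) = g (W.filter (fun c' => c' ∉ A))) :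
    ∀ g : Finset (Fin h) → ℂ, ∃ cV : Finset (Fin h) → ℂ, ∀ W ∈ 𝒲,
      ∑ V ∈ 𝒦A ∪ 𝒦B, cV V * coeff (∑ a ∈ (∅ : Finset (Fin h)), Finsupp.single (Fin.castAdd h a) 1 +
        ∑ c' ∈ W, Finsupp.single (Fin.natAdd h c') 1)
        (∏ V' ∈ (𝒦A ∪ 𝒦B).erase V, (C 1 + ∑ a, C ((fun (_ : Fin h) (_ : Finset (Fin h)) => (0 : ℂ)) a V') *
        X (Fin.castAdd h a) + ∑ c', C (if c' ∈ V' then (1 : ℂ) else 0) * X (Fin.natAdd h c') :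
          MvPolynomial (Fin (h + h)) ℂ)) = g W := by
  classical
  intro g
  -- the two full products on squarefree monomials
  set BA : Finset (Fin h) → ℂ := fun X' => coeff (∑ a ∈ (∅ : Finset (Fin h)),
      Finsupp.single (Fin.castAdd h a) 1 + ∑ c' ∈ X', Finsupp.single (Fin.natAdd h c') 1)
    (∏ V ∈ 𝒦A, (C 1 + ∑ a, C ((fun (_ : Fin h) (_ : Finset (Fin h)) => (0 : ℂ)) a V) *
        X (Fin.castAdd h a) + ∑ c', C (if c' ∈ V then (1 : ℂ) else 0) * X (Fin.natAdd h c') :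
          MvPolynomial (Fin (h + h)) ℂ)) with hBA
  set BB : Finset (Fin h) → ℂ := fun X' => coeff (∑ a ∈ (∅ : Finset (Fin h)),
      Finsupp.single (Fin.castAdd h a) 1 + ∑ c' ∈ X', Finsupp.single (Fin.natAdd h c') 1)
    (∏ V ∈ 𝒦B, (C 1 + ∑ a, C ((fun (_ : Fin h) (_ : Finset (Fin h)) => (0 : ℂ)) a V) *
        X (Fin.castAdd h a) + ∑ c', C (if c' ∈ V then (1 : ℂ) else 0) * X (Fin.natAdd h c') :
          MvPolynomial (Fin (h + h)) ℂ)) with hBB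
  set γ : ℂ := g (a₀ ∪ b₀) / BA a₀ with hγ
  set gB : Finset (Fin h) → ℂ := fun X' => g (a₀ ∪ X') / BA a₀ with hgB
  set gA : Finset (Fin h) → ℂ := fun Y => if Y = a₀ then 0 else (g (Y ∪ b₀) - BA Y * γ) / BB b₀
    with hgA
  obtain ⟨cA, hcA⟩ := hspanA gA
  obtain ⟨cB, hcB⟩ := hspanB gB
  refine ⟨fun V => (if V ∈ 𝒦A then cA V else 0) + (if V ∈ 𝒦B then cB V else 0), fun W hW => ?_⟩
  have hsplit : ∑ V ∈ 𝒦A ∪ 𝒦B, ((if V ∈ 𝒦A then cA V else 0) + (if V ∈ 𝒦B then cB V else 0)) *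
      coeff (∑ a ∈ (∅ : Finset (Fin h)), Finsupp.single (Fin.castAdd h a) 1 +
        ∑ c' ∈ W, Finsupp.single (Fin.natAdd h c') 1)
        (∏ V' ∈ (𝒦A ∪ 𝒦B).erase V, (C 1 + ∑ a, C ((fun (_ : Fin h) (_ : Finset (Fin h)) => (0 : ℂ)) a V') *
        X (Fin.castAdd h a) + ∑ c', C (if c' ∈ V' then (1 : ℂ) else 0) * X (Fin.natAdd h c') :
          MvPolynomial (Fin (h + h)) ℂ)) =
      (∑ V ∈ 𝒦A, cA V * coeff (∑ a ∈ (∅ : Finset (Fin h)), Finsupp.single (Fin.castAdd h a) 1 +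
        ∑ c' ∈ W.filter (fun c' => c' ∈ A), Finsupp.single (Fin.natAdd h c') 1)
        (∏ V' ∈ 𝒦A.erase V, (C 1 + ∑ a, C ((fun (_ : Fin h) (_ : Finset (Fin h)) => (0 : ℂ)) a V') *
        X (Fin.castAdd h a) + ∑ c', C (if c' ∈ V' then (1 : ℂ) else 0) * X (Fin.natAdd h c') :
          MvPolynomial (Fin (h + h)) ℂ))) * BB (W.filter (fun c' => c' ∉ A)) +
      BA (W.filter (fun c' => c' ∈ A)) * (∑ V ∈ 𝒦B, cB V *
        coeff (∑ a ∈ (∅ : Finset (Fin h)), Finsupp.single (Fin.castAdd h a) 1 +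
        ∑ c' ∈ W.filter (fun c' => c' ∉ A), Finsupp.single (Fin.natAdd h c') 1)
        (∏ V' ∈ 𝒦B.erase V, (C 1 + ∑ a, C ((fun (_ : Fin h) (_ : Finset (Fin h)) => (0 : ℂ)) a V') *
        X (Fin.castAdd h a) + ∑ c', C (if c' ∈ V' then (1 : ℂ) else 0) * X (Fin.natAdd h c') :
          MvPolynomial (Fin (h + h)) ℂ))) := by
    simp only [add_mul, Finset.sum_add_distrib]
    congr 1
    · rw [Finset.sum_mul, ← Finset.sum_subset Finset.subset_union_left (fun V _ hV => by
        rw [if_neg hV, zero_mul])]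
      refine Finset.sum_congr rfl fun V hV => ?_
      rw [if_pos hV, coeff_looProd_union_of_mem_left 𝒦A 𝒦B A hA hB V hV W]
      ring
    · rw [Finset.mul_sum, ← Finset.sum_subset Finset.subset_union_right (fun V _ hV => by
        rw [if_neg hV, zero_mul])]
      refine Finset.sum_congr rfl fun V hV => ?_
      rw [if_pos hV, coeff_looProd_union_of_mem_right 𝒦A 𝒦B A hA hB V hV W]
      ring
  rw [hsplit, hcA W hW, hcB W hW]
  have ha₀' : BA a₀ ≠ 0 := ha₀
  have hb₀' : BB b₀ ≠ 0 := hb₀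
  have hWsplit : W.filter (fun c' => c' ∈ A) ∪ W.filter (fun c' => c' ∉ A) = W :=
    Finset.filter_union_filter_not_eq _ W
  by_cases hWa : W.filter (fun c' => c' ∈ A) = a₀
  · have hWeq : a₀ ∪ W.filter (fun c' => c' ∉ A) = W := by rw [← hWa]; exact hWsplit
    rw [hWa, hgA, hgB]
    dsimp only
    rw [if_pos rfl, hWeq]
    field_simp
    ring
  · have hWb : W.filter (fun c' => c' ∉ A) = b₀ := (hcross W hW).resolve_right hWa
    have hWeq : W.filter (fun c' => c' ∈ A) ∪ b₀ = W := by rw [← hWb]; exact hWsplit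
    rw [hWb, hgA, hgB]
    dsimp only
    rw [if_neg hWa, hWeq, hγ]
    field_simp
    ring


/-! ## 2. The slice theorem for crosses of two small shadows -/

/-- **CROSS OF TWO SMALL SHADOWS, every height** (item `ChowHitsThinRowPartitionMinors`,
stmt-ValiantsHypothesis-20195, first-order rows): let the columns `w j` form a cross over a
coordinate set `A` — each has `A`-free part `b₀` or `A`-part `a₀` (`a₀ ⊆ A`, `b₀ ∩ A = ∅`) — and let
the down-closure of the `A`-parts (together with `a₀`) and the down-closure of the `A`-free parts
(together with `b₀`) have at most `h + h` members in total.  Then every partition minor with injective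
rows of size `≤ 1` and these (injective) columns is nonzero at one explicit product of `h + h` affine
forms.  Example: two squares glued at a vertex, `{∅,0,1,01,012,013,0123}` (`A = {0,1}`, `a₀ = 01`,
`b₀ = ∅`; `4 + 4 ≤ 2h`). -/
theorem chowHits_firstOrderRows_of_crossSmallShadows (h : ℕ) (A a₀ b₀ : Finset (Fin h))
    (ha₀A : a₀ ⊆ A) (hb₀A : ∀ c ∈ b₀, c ∉ A)
    (r : ℕ) (u w : Fin r → Finset (Fin h))
    (hu : Function.Injective u) (hw : Function.Injective w) (hu1 : ∀ i, (u i).card ≤ 1)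
    (hcross : ∀ j, (w j).filter (fun c' => c' ∉ A) = b₀ ∨ (w j).filter (fun c' => c' ∈ A) = a₀)
    (hbudget : ((insert a₀ ((Finset.univ : Finset (Fin r)).image
        (fun j => (w j).filter (fun c' => c' ∈ A)))).biUnion Finset.powerset).card +
      ((insert b₀ ((Finset.univ : Finset (Fin r)).image
        (fun j => (w j).filter (fun c' => c' ∉ A)))).biUnion Finset.powerset).card ≤ h + h) :
    ∃ ℓ : Fin (h + h) → MvPolynomial (Fin (h + h)) ℂ, (∀ k, (ℓ k).totalDegree ≤ 1) ∧
      (Matrix.of fun i j : Fin r => MvPolynomial.coeff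
        (∑ a ∈ u i, Finsupp.single (Fin.castAdd h a) 1 +
          ∑ c ∈ w j, Finsupp.single (Fin.natAdd h c) 1) (∏ k, ℓ k)).det ≠ 0 := by
  classical
  set 𝒲 : Finset (Finset (Fin h)) := (Finset.univ : Finset (Fin r)).image w with h𝒲
  set 𝒲A : Finset (Finset (Fin h)) := insert a₀ ((Finset.univ : Finset (Fin r)).image
    (fun j => (w j).filter (fun c' => c' ∈ A))) with h𝒲A
  set 𝒲B : Finset (Finset (Fin h)) := insert b₀ ((Finset.univ : Finset (Fin r)).image
    (fun j => (w j).filter (fun c' => c' ∉ A))) with h𝒲B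
  set DA : Finset (Finset (Fin h)) := 𝒲A.biUnion Finset.powerset with hDAdef
  set DB : Finset (Finset (Fin h)) := 𝒲B.biUnion Finset.powerset with hDBdef
  have hDA : ∀ W ∈ DA, ∀ U : Finset (Fin h), U ⊆ W → U ∈ DA := by
    intro W hW U hU
    rw [hDAdef, Finset.mem_biUnion] at hW ⊢
    obtain ⟨W', hW', hWW'⟩ := hW
    exact ⟨W', hW', Finset.mem_powerset.mpr (hU.trans (Finset.mem_powerset.mp hWW'))⟩
  have hDB : ∀ W ∈ DB, ∀ U : Finset (Fin h), U ⊆ W → U ∈ DB := by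
    intro W hW U hU
    rw [hDBdef, Finset.mem_biUnion] at hW ⊢
    obtain ⟨W', hW', hWW'⟩ := hW
    exact ⟨W', hW', Finset.mem_powerset.mpr (hU.trans (Finset.mem_powerset.mp hWW'))⟩
  have h𝒲A_sub : ∀ X ∈ 𝒲A, X ⊆ A := by
    intro X hX
    rw [h𝒲A, Finset.mem_insert, Finset.mem_image] at hX
    rcases hX with rfl | ⟨j, _, rfl⟩
    · exact ha₀A
    · intro c hc; exact (Finset.mem_filter.mp hc).2
  have h𝒲B_sub : ∀ X ∈ 𝒲B, ∀ c ∈ X, c ∉ A := by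
    intro X hX
    rw [h𝒲B, Finset.mem_insert, Finset.mem_image] at hX
    rcases hX with rfl | ⟨j, _, rfl⟩
    · exact hb₀A
    · intro c hc; exact (Finset.mem_filter.mp hc).2
  have hA : ∀ V ∈ DA, V ⊆ A := by
    intro V hV
    rw [hDAdef, Finset.mem_biUnion] at hV
    obtain ⟨X, hX, hVX⟩ := hV
    exact (Finset.mem_powerset.mp hVX).trans (h𝒲A_sub X hX)
  have hB : ∀ V ∈ DB, ∀ c ∈ V, c ∉ A := by
    intro V hV c hc
    rw [hDBdef, Finset.mem_biUnion] at hV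
    obtain ⟨X, hX, hVX⟩ := hV
    exact h𝒲B_sub X hX c (Finset.mem_powerset.mp hVX hc)
  have hmemA : ∀ X ∈ 𝒲A, X ∈ DA := fun X hX =>
    Finset.mem_biUnion.mpr ⟨X, hX, Finset.mem_powerset.mpr (subset_refl X)⟩
  have hmemB : ∀ X ∈ 𝒲B, X ∈ DB := fun X hX =>
    Finset.mem_biUnion.mpr ⟨X, hX, Finset.mem_powerset.mpr (subset_refl X)⟩
  have hprojA : ∀ W ∈ 𝒲, W.filter (fun c' => c' ∈ A) ∈ 𝒲A := by
    intro W hW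
    rw [h𝒲, Finset.mem_image] at hW
    obtain ⟨j, _, rfl⟩ := hW
    exact Finset.mem_insert_of_mem (Finset.mem_image_of_mem _ (Finset.mem_univ j))
  have hprojB : ∀ W ∈ 𝒲, W.filter (fun c' => c' ∉ A) ∈ 𝒲B := by
    intro W hW
    rw [h𝒲, Finset.mem_image] at hW
    obtain ⟨j, _, rfl⟩ := hW
    exact Finset.mem_insert_of_mem (Finset.mem_image_of_mem _ (Finset.mem_univ j))
  have hposA := fun W (hW : W ∈ 𝒲) =>
    coeff_prod_ne_zero_of_downClosed DA hDA _ (hmemA _ (hprojA W hW))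
  have hposB := fun W (hW : W ∈ 𝒲) =>
    coeff_prod_ne_zero_of_downClosed DB hDB _ (hmemB _ (hprojB W hW))
  have hspan := span_union_of_cross DA DB A a₀ b₀ 𝒲 hA hB
    (fun W hW => by
      rw [h𝒲, Finset.mem_image] at hW
      obtain ⟨j, _, rfl⟩ := hW
      exact hcross j)
    (coeff_prod_ne_zero_of_downClosed DA hDA a₀ (hmemA a₀ (Finset.mem_insert_self _ _)))
    (coeff_prod_ne_zero_of_downClosed DB hDB b₀ (hmemB b₀ (Finset.mem_insert_self _ _)))
    (fun g => by
      obtain ⟨cV, hcV⟩ := span_of_downClosed DA hDA g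
      exact ⟨cV, fun W hW => hcV _ (hmemA _ (hprojA W hW))⟩)
    (fun g => by
      obtain ⟨cV, hcV⟩ := span_of_downClosed DB hDB g
      exact ⟨cV, fun W hW => hcV _ (hmemB _ (hprojB W hW))⟩)
  have hpos := pos_union_of_cross DA DB A 𝒲 hA hB hposA hposB
  exact chowHits_firstOrderRows_of_spanPos (DA ∪ DB) 𝒲
    ((Finset.card_union_le DA DB).trans hbudget) hpos hspan r u w hu hw hu1
    (fun j => Finset.mem_image_of_mem w (Finset.mem_univ j))

end Summit.ValiantsHypothesis.ValiantsHypothesis.Theorems.BarrierLever.ChowTwinPeel
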